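import Literature.Probability.RandomPlanarGeometry.SAWAdsorptionUpperBound207
import HarnessLib

/-!
# `a_c ≤ 2.065`: the last digit the length-`20` census supports at rate `2.69`

Topic `Literature/Probability/RandomPlanarGeometry` (continues `SAWAdsorptionUpperBound207.lean`: the census
`AdsIrr.cTab20` of irreducible wall-returning `x`-bridges by length `m ≤ 20` and wall visits, and the free-energy
certificate `Zd.adsorbedAbove_of_fTab20`). No new computation: `Σ_{m ≤ 20} Σ_v c(m,v) (413/200)^v (100/269)^m
= 1.00008… ≥ 1` (`norm_num`), hence **`Zd.adsorbedAbove_2065 : AdsorbedAbove (413/200) (269/100)`** — the adsorbed free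
energy at `a = 2.065` is at least `log 2.69 > log μ(ℤ²)`, i.e. `a_c ≤ 2.065` (the length-`20` table cannot certify
`2.06`: its sum there is `0.99702`). Axioms: standard plus the inherited `native_decide` census certificates.
-/

open Finset
open scoped BigOperators

namespace Literature.Probability.RandomPlanarGeometry.SAW

namespace AdsIrr

/-- The numeral at `a = 413/200`: `Σ_{m=1}^{20} f_m(2.065) (100/269)^m ≥ 1` (`= 1.00008…`).
[cite: BeatonGuttmannJensen2012Adsorption, §1 (p. 2)] -/
theorem one_le_sum_fTab20_2065 : (1 : ℝ) ≤ ∑ m ∈ Icc 1 20, fTab20 (413 / 200) m / (269 / 100) ^ m := by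
  rw [← Finset.Ico_add_one_right_eq_Icc, Finset.sum_Ico_eq_sum_range]
  simp only [Finset.sum_range_succ, Finset.sum_range_zero, fTab20, cTab20, List.length_cons, List.length_nil,
    List.getD_cons_zero, List.getD_cons_succ, Nat.reduceAdd]
  norm_num

end AdsIrr

/-- **`AdsorbedAbove (413/200) (269/100)`** — `a_c ≤ 2.065` for the square-lattice adsorption point, from the length-`20`
census. [cite: BeatonGuttmannJensen2012Adsorption, §1 (p. 2)] [cite: MadrasSlade1993, §4.2, eq. (4.2.2)–(4.2.4) (pp. 89–91)] -/
theorem Zd.adsorbedAbove_2065 : Zd.AdsorbedAbove (413 / 200) (269 / 100) :=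
  Zd.adsorbedAbove_of_fTab20 (by norm_num) (by norm_num) AdsIrr.one_le_sum_fTab20_2065

end Literature.Probability.RandomPlanarGeometry.SAW
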